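import Summits.AnomalousDissipation.AnomalousDissipation.Theorems.EnsembleCeiling.Negative.SingleModeFat

/-!
# Negative knowledge for the crux `ResidualTransferSSS` (stmt-AnomalousDissipation-15510), I:
# laminar atoms — ray states of a single mode, their Dirac masses, and the two sides of the defect bound

Crux `EnsembleRigidity.ResidualTransferSSS` (route `AnomalousDissipation/EnsembleRigidity`, rank 4) says: for
`ν > 0`, an admissible force `f` and a stationary statistical solution `μ` of `NS_ν(f)` (FMRT IV Def. 1.3,
`Torus.IsStationaryStatisticalSolution`) with integrable energy, (a) the work `∫_shell (v, f) dμ` is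
non-negative on every energy shell and (b) the forced-Euler defect of `μ` against every cylindrical test
functional obeys `|∫ ⟨F₀(v), Φ'(v)⟩ dμ| ≤ ν (∫‖∇v‖² dμ)^{1/2} (∫ ‖∇Φ'(v)‖² dμ)^{1/2}`.
This file (cdisprove seat `refuter-cdisprove-stmt-AnomalousDissipation-15510-0`) builds the SMALL MODELS used by
part II (`Negative/DefectBoundSharp.lean`); nothing here asserts a Theses statement. The models are the LAMINAR
ATOMS: Dirac masses at the ray states `c · Re(e_k z)` of a single transversal mode `f = Re(e_k z)` (`k ≠ 0`,
`k · z = 0`), which are steady states of `NS_ν(f)` exactly when `4π²|k|² ν c = 1` (tree toolkit of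
`Theorems/TaylorCertificatePair/Negative/` and `Theorems/EnsembleCeiling/Negative/SingleModeFat`).

* `toReal_eGradNormSq_mode` — exact gradient norm of a mode, `‖∇Re(e_k z)‖² = 4π²|k|² ∫‖Re(e_k z)‖²`;
* `exists_cylindricalTest_grad_eq` — every test field `w ∈ 𝒱` is `Φ'(u)` for some cylindrical `Φ`
  (localisation of the Liouville equation (1.30) at a state);
* `exists_rayState`, `ray_pairing`, `ray_norm_sq`, `ray_eGradNormSq`, `ray_nsGeneratorPairing`
  (`⟨F_ν(u), w⟩ = (1 - 4π²|k|²νc) Re⟪z, ŵ(k)⟫`), `ray_eulerDefect_self` (`⟨F₀(u), f⟩ = ½‖z‖²`);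
* `ray_dirac_isStationary` — on the laminar branch `4π²|k|²νc = 1` the Dirac mass is a stationary statistical
  solution (ANY sign of `ν`); `ray_dirac_subStationary` — for `0 ≤ 4π²|k|²νc ≤ 1` it satisfies every clause of
  FMRT IV Def. 1.3 except (1.30);
* `ray_defect_lhs`, `ray_defect_rhs` — the two sides of (b) at a ray Dirac mass with `Φ'(u) = f`:
  `½‖z‖²` versus `4π²|k|²νc · ½‖z‖²`.
-/

noncomputable section

open MeasureTheory UnitAddTorus Matrix
open scoped InnerProductSpace ENNReal ComplexConjugate

namespace Summit.AnomalousDissipation.AnomalousDissipation.Theorems.ResidualTransferSSS.Negative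

open Literature.Analysis.FunctionSpaces Literature.Analysis.FluidPDE
open Summit.AnomalousDissipation.AnomalousDissipation.Theorems.TaylorCertificatePair.Negative
open Summit.AnomalousDissipation.AnomalousDissipation.Theorems.EnsembleCeiling.Negative

variable {k : Fin 3 → ℤ} {z : EuclideanSpace ℂ (Fin 3)}

/-! ### Toolkit: exact gradient norm of a mode; localising cylindrical tests -/

/-- **Exact gradient norm of a single mode**: `‖∇ Re(e_k z)‖² = 4π²|k|² ∫ ‖Re(e_k z)‖²`
(the Fourier support is `{k, -k}`, both of squared length `|k|²`). -/
theorem toReal_eGradNormSq_mode (k : Fin 3 → ℤ) (z' : EuclideanSpace ℂ (Fin 3)) :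
    (Torus.eGradNormSq (Torus.realTrigPoly {k} (fun _ => z'))).toReal =
      4 * Real.pi ^ 2 * Torus.freqNormSq k * ∫ x, ‖(Torus.realTrigPoly {k} (fun _ => z')) x‖ ^ 2 := by
  obtain ⟨N, hN⟩ : ∃ N : ℕ, Torus.freqNormSq k ≤ (N : ℝ) ^ 2 := by
    refine ⟨⌈Torus.freqNormSq k⌉₊ + 1, ?_⟩
    have h1 : Torus.freqNormSq k ≤ ((⌈Torus.freqNormSq k⌉₊ + 1 : ℕ) : ℝ) :=
      (Nat.le_ceil _).trans (by push_cast; linarith)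
    have h2 : (1 : ℝ) ≤ ((⌈Torus.freqNormSq k⌉₊ + 1 : ℕ) : ℝ) := by
      push_cast; linarith [Nat.cast_nonneg (α := ℝ) ⌈Torus.freqNormSq k⌉₊]
    nlinarith
  have hband : ∀ κ, (N : ℝ) ^ 2 < Torus.freqNormSq κ →
      mFourierCoeff (EuclideanSpace.complexify ∘ (Torus.realTrigPoly {k} (fun _ => z'))) κ = 0 :=
    fun κ hκ => fc_mode_eq_zero z' (hN.trans_lt hκ)
  rw [Torus.eGradNormSq_eq_sum_of_band_limited (continuous_mode k z') hband,
    Torus.integral_norm_sq_eq_sum_of_band_limited (continuous_mode k z') hband,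
    ENNReal.toReal_ofReal (mul_nonneg (by positivity) (Finset.sum_nonneg fun κ _ =>
      mul_nonneg (Torus.freqNormSq_nonneg κ) (sq_nonneg _))), Finset.mul_sum, Finset.mul_sum]
  refine Finset.sum_congr rfl fun κ _ => ?_
  have hterm : Torus.freqNormSq κ * ‖mFourierCoeff (EuclideanSpace.complexify ∘ (Torus.realTrigPoly {k} (fun _ => z'))) κ‖ ^ 2 =
      Torus.freqNormSq k * ‖mFourierCoeff (EuclideanSpace.complexify ∘ (Torus.realTrigPoly {k} (fun _ => z'))) κ‖ ^ 2 := by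
    by_cases h1 : κ = k
    · rw [h1]
    · by_cases h2 : κ = -k
      · rw [h2, Torus.freqNormSq_neg]
      · rw [fc_mode, if_neg h1, if_neg h2, EuclideanSpace.conjVec_zero, add_zero, smul_zero, norm_zero]
        simp
  rw [hterm]
  ring

/-- Exact gradient norm of a single mode with nonzero frequency: `‖∇ Re(e_k z)‖² = 2π²|k|²‖z‖²`. -/
theorem toReal_eGradNormSq_mode_eq (hk : k ≠ 0) (z' : EuclideanSpace ℂ (Fin 3)) :
    (Torus.eGradNormSq (Torus.realTrigPoly {k} (fun _ => z'))).toReal =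
      4 * Real.pi ^ 2 * Torus.freqNormSq k * (2⁻¹ * ‖z'‖ ^ 2) := by
  rw [toReal_eGradNormSq_mode, integral_norm_sq_mode hk]

/-- The derivative-based gradient norm of a single mode with nonzero frequency. -/
theorem gradNormSq_mode_eq (hk : k ≠ 0) (z' : EuclideanSpace ℂ (Fin 3)) :
    Torus.gradNormSq (Torus.realTrigPoly {k} (fun _ => z')) =
      4 * Real.pi ^ 2 * Torus.freqNormSq k * (2⁻¹ * ‖z'‖ ^ 2) := by
  rw [Torus.gradNormSq_eq_toReal_eGradNormSq_holds (isSmooth_mode k z'), toReal_eGradNormSq_mode_eq hk]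

/-- **Localisation of the Liouville equation.** Every test field `w ∈ 𝒱` is the differential at a
given state `u ∈ H` of some cylindrical test functional: the single coordinate `(·, w)` with profile
`φ(y) = (y₀ - (u, w)) χ(y)`, `χ` a smooth bump `≡ 1` near `(u, w)`, has `Φ'(u) = w`. -/
theorem exists_cylindricalTest_grad_eq (u : Torus.energySpace (Fin 3))
    {w : UnitAddTorus (Fin 3) → EuclideanSpace ℝ (Fin 3)} (hw : Torus.IsSmooth w)
    (hdw : Torus.IsDivFree w) (hzw : Torus.HasZeroMean w) :
    ∃ Φ : Torus.CylindricalTest (Fin 3), Φ.grad u = w := by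
  set c : ℝ := Torus.pairing ((u : Torus.energySpace (Fin 3)) : Lp (EuclideanSpace ℝ (Fin 3)) 2 (volume : Measure (UnitAddTorus (Fin 3)))) w with hc
  set y₀ : EuclideanSpace ℝ (Fin 1) := WithLp.toLp 2 (fun _ => c) with hy₀
  let χ : ContDiffBump y₀ := default
  set a : EuclideanSpace ℝ (Fin 1) → ℝ := fun y => EuclideanSpace.proj (𝕜 := ℝ) (0 : Fin 1) y - c with ha
  have ha_diff : ContDiff ℝ 1 a := ((EuclideanSpace.proj (𝕜 := ℝ) (0 : Fin 1)).contDiff).sub contDiff_const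
  have hχ_diff : ContDiff ℝ 1 (χ : EuclideanSpace ℝ (Fin 1) → ℝ) := χ.contDiff
  let Φ : Torus.CylindricalTest (Fin 3) :=
    { m := 1
      g := fun _ => w
      g_smooth := fun _ => hw
      g_divFree := fun _ => hdw
      g_zeroMean := fun _ => hzw
      φ := fun y => a y * χ y
      φ_contDiff := ha_diff.mul hχ_diff
      φ_compact := χ.hasCompactSupport.mul_left }
  have hcoords : Φ.coords u = y₀ := rfl
  have ha0 : a y₀ = 0 := by
    simp [ha, hy₀]
  have hχ1 : (χ : EuclideanSpace ℝ (Fin 1) → ℝ) y₀ = 1 := χ.one_of_mem_closedBall (Metric.mem_closedBall_self χ.rIn_pos.le)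
  have hderiv : _root_.fderiv ℝ Φ.φ (Φ.coords u) (EuclideanSpace.single (0 : Fin 1) (1 : ℝ)) = 1 := by
    rw [hcoords]
    change _root_.fderiv ℝ (fun y => a y * χ y) y₀ (EuclideanSpace.single (0 : Fin 1) (1 : ℝ)) = 1
    have hfun : (fun y => a y * (χ : EuclideanSpace ℝ (Fin 1) → ℝ) y) = a * (χ : EuclideanSpace ℝ (Fin 1) → ℝ) := rfl
    rw [hfun, fderiv_mul (ha_diff.differentiable one_ne_zero y₀) (hχ_diff.differentiable one_ne_zero y₀), ha0, hχ1,
      zero_smul, zero_add, one_smul]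
    rw [ha, fderiv_sub_const, ContinuousLinearMap.fderiv]
    simp
  refine ⟨Φ, ?_⟩
  funext x
  change ∑ i : Fin 1, (_root_.fderiv ℝ Φ.φ (Φ.coords u) (EuclideanSpace.single i 1)) • Φ.g i x = w x
  rw [Fin.sum_univ_one, hderiv, one_smul]


/-! ### Ray states of a single transversal mode and their Dirac masses -/

/-- **Ray states.** For a transversal mode (`k ≠ 0`, `k · z = 0`) and `c ∈ ℝ`, the field `c · Re(e_k z)`
is (a.e.) the representative of a state `u ∈ V ⊆ H`. -/
theorem exists_rayState (hk : k ≠ 0) (hz : ((fun j => ((k) j : ℂ)) ⬝ᵥ (WithLp.ofLp z)) = 0) (c : ℝ) :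
    ∃ u : (Torus.energySpace (Fin 3)), (((u : (Torus.energySpace (Fin 3))) : (Lp (EuclideanSpace ℝ (Fin 3)) 2 (volume : Measure (UnitAddTorus (Fin 3))))) : (UnitAddTorus (Fin 3) → EuclideanSpace ℝ (Fin 3))) =ᵐ[volume] Torus.realTrigPoly {k} (fun _ => ((c : ℂ) • z)) ∧
      ((u : (Torus.energySpace (Fin 3))) : (Lp (EuclideanSpace ℝ (Fin 3)) 2 (volume : Measure (UnitAddTorus (Fin 3))))) ∈ Torus.energySpaceV (Fin 3) := by
  set uf : (UnitAddTorus (Fin 3) → EuclideanSpace ℝ (Fin 3)) := Torus.realTrigPoly {k} (fun _ => ((c : ℂ) • z)) with huf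
  have hzc : ((fun j => ((k) j : ℂ)) ⬝ᵥ (WithLp.ofLp (((c : ℂ) • z)))) = 0 := by
    rw [dotc_smul, hz, mul_zero]
  have hsm : Torus.IsSmooth uf := isSmooth_mode k _
  have hdf : Torus.IsDivFree uf := Torus.isDivFree_realTrigPoly_singleton hzc
  have hzm : Torus.HasZeroMean uf := hasZeroMean_mode hk _
  have hmem : MemLp uf 2 volume := hsm.memLp 2
  refine ⟨⟨hmem.toLp uf, Torus.smoothSolenoidal_subset_energySpace ⟨uf, hsm, hdf, hzm, hmem.coeFn_toLp⟩⟩,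
    hmem.coeFn_toLp, ?_⟩
  exact Torus.smoothSolenoidal_subset_energySpaceV_holds ⟨uf, hsm, hdf, hzm, hmem.coeFn_toLp⟩

section Ray

variable (hk : k ≠ 0) (hz : ((fun j => ((k) j : ℂ)) ⬝ᵥ (WithLp.ofLp z)) = 0) {c : ℝ} {u : (Torus.energySpace (Fin 3))}
  (hu : (((u : (Torus.energySpace (Fin 3))) : (Lp (EuclideanSpace ℝ (Fin 3)) 2 (volume : Measure (UnitAddTorus (Fin 3))))) : (UnitAddTorus (Fin 3) → EuclideanSpace ℝ (Fin 3))) =ᵐ[volume] Torus.realTrigPoly {k} (fun _ => ((c : ℂ) • z)))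

include hu in
/-- Work of the mode on its ray state: `(u, f) = ½ c ‖z‖²`. -/
theorem ray_pairing (hk : k ≠ 0) : Torus.pairing ((u : (Torus.energySpace (Fin 3))) : (Lp (EuclideanSpace ℝ (Fin 3)) 2 (volume : Measure (UnitAddTorus (Fin 3))))) (Torus.realTrigPoly {k} (fun _ => z)) = 2⁻¹ * (c * ‖z‖ ^ 2) := by
  rw [pairing_of_ae hu, integral_inner_mode_mode hk, inner_smul_left, Complex.conj_ofReal,
    Complex.re_ofReal_mul, inner_self_eq_norm_sq_to_K]
  norm_cast

include hu in
/-- Energy of the ray state: `|u|² = ½ c² ‖z‖²`. -/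
theorem ray_norm_sq (hk : k ≠ 0) : ‖u‖ ^ 2 = 2⁻¹ * (c ^ 2 * ‖z‖ ^ 2) := by
  rw [norm_sq_of_ae hu, integral_norm_sq_mode hk, norm_smul, Complex.norm_real, Real.norm_eq_abs, mul_pow,
    sq_abs]

include hu in
/-- Enstrophy of the ray state: `‖u‖_V² = 4π²|k|² · ½ c² ‖z‖²` (exact). -/
theorem ray_eGradNormSq (hk : k ≠ 0) :
    (Torus.eGradNormSq (((u : (Torus.energySpace (Fin 3))) : (Lp (EuclideanSpace ℝ (Fin 3)) 2 (volume : Measure (UnitAddTorus (Fin 3))))) : (UnitAddTorus (Fin 3) → EuclideanSpace ℝ (Fin 3)))).toReal = 4 * Real.pi ^ 2 * Torus.freqNormSq k * (2⁻¹ * (c ^ 2 * ‖z‖ ^ 2)) := by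
  rw [eGradNormSq_congr_ae' hu, toReal_eGradNormSq_mode_eq hk, norm_smul, Complex.norm_real, Real.norm_eq_abs,
    mul_pow, sq_abs]

include hu in
/-- The ray state has finite enstrophy. -/
theorem ray_eGradNormSq_lt_top : Torus.eGradNormSq (((u : (Torus.energySpace (Fin 3))) : (Lp (EuclideanSpace ℝ (Fin 3)) 2 (volume : Measure (UnitAddTorus (Fin 3))))) : (UnitAddTorus (Fin 3) → EuclideanSpace ℝ (Fin 3))) < ⊤ := by
  rw [eGradNormSq_congr_ae' hu]
  exact Torus.eGradNormSq_lt_top (isSmooth_mode k _)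

include hz hu in
/-- **The Navier–Stokes generator at a ray state**, against any smooth field `w`:
`⟨F_ν(u), w⟩ = (1 - 4π²|k|² ν c) · Re ⟪z, ŵ(k)⟫` (the inertial term of a transversal mode vanishes). -/
theorem ray_nsGeneratorPairing (ν : ℝ) {w : (UnitAddTorus (Fin 3) → EuclideanSpace ℝ (Fin 3))} (hw : Torus.IsSmooth w) :
    Torus.nsGeneratorPairing ν (Torus.realTrigPoly {k} (fun _ => z)) u w =
      (1 - ν * (4 * Real.pi ^ 2 * Torus.freqNormSq k) * c) * (⟪z, mFourierCoeff (EuclideanSpace.complexify ∘ w) k⟫_ℂ).re := by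
  have hzc : ((fun j => ((k) j : ℂ)) ⬝ᵥ (WithLp.ofLp (((c : ℂ) • z)))) = 0 := by
    rw [dotc_smul, hz, mul_zero]
  rw [nsGeneratorPairing_of_ae hu, inertial_mode hzc hw, add_zero, integral_inner_mode_left hw.integrable,
    integral_inner_mode_laplacian hw, inner_smul_left, Complex.conj_ofReal, Complex.re_ofReal_mul]
  ring

include hz hu in
/-- The forced-EULER generator of the mode at a ray state, tested against the mode itself:
`⟨F₀(u), f⟩ = (f, f) = ½‖z‖²` — independent of `c`. -/
theorem ray_eulerDefect_self (hk : k ≠ 0) :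
    Torus.nsGeneratorPairing 0 (Torus.realTrigPoly {k} (fun _ => z)) u (Torus.realTrigPoly {k} (fun _ => z)) = 2⁻¹ * ‖z‖ ^ 2 := by
  have hzc : ((fun j => ((k) j : ℂ)) ⬝ᵥ (WithLp.ofLp (((c : ℂ) • z)))) = 0 := by
    rw [dotc_smul, hz, mul_zero]
  rw [nsGeneratorPairing_of_ae hu, inertial_mode hzc (isSmooth_mode k z), add_zero, zero_mul, add_zero,
    integral_inner_mode_mode hk z z, inner_self_eq_norm_sq_to_K]
  norm_cast

include hz hu in
/-- **Ray states on the laminar branch are steady states**: if `4π²|k|² ν c = 1` then `u` is a steady weak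
solution of `NS_ν(Re(e_k z))` (any sign of `ν`). -/
theorem ray_isSteadyWeakSolution {ν : ℝ} (hνc : ν * (4 * Real.pi ^ 2 * Torus.freqNormSq k) * c = 1) :
    Torus.IsSteadyWeakSolution ν (Torus.realTrigPoly {k} (fun _ => z)) u := by
  intro w hw _ _
  rw [ray_nsGeneratorPairing hz hu ν hw, hνc, sub_self, zero_mul]

include hz hu in
/-- **Laminar Dirac masses are stationary statistical solutions** (FMRT IV Def. 1.3, all three clauses; any
sign of `ν`): if `4π²|k|² ν c = 1`, then `δ_u` is a stationary statistical solution of `NS_ν(Re(e_k z))`. -/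
theorem ray_dirac_isStationary (hk : k ≠ 0) (hV : ((u : (Torus.energySpace (Fin 3))) : (Lp (EuclideanSpace ℝ (Fin 3)) 2 (volume : Measure (UnitAddTorus (Fin 3))))) ∈ Torus.energySpaceV (Fin 3)) {ν : ℝ}
    (hνc : ν * (4 * Real.pi ^ 2 * Torus.freqNormSq k) * c = 1) :
    Torus.IsStationaryStatisticalSolution ν (Torus.realTrigPoly {k} (fun _ => z)) (Measure.dirac u) := by
  refine (ray_isSteadyWeakSolution hz hu hνc).isStationaryStatisticalSolution_dirac hV (le_of_eq ?_)
  rw [ray_eGradNormSq hu hk, ray_pairing hu hk]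
  calc ν * (4 * Real.pi ^ 2 * Torus.freqNormSq k * (2⁻¹ * (c ^ 2 * ‖z‖ ^ 2)))
      = (ν * (4 * Real.pi ^ 2 * Torus.freqNormSq k) * c) * (2⁻¹ * (c * ‖z‖ ^ 2)) := by ring
    _ = 2⁻¹ * (c * ‖z‖ ^ 2) := by rw [hνc, one_mul]

include hu in
/-- **Sub-laminar Dirac masses satisfy every clause of FMRT IV Def. 1.3 except the Liouville equation**:
for `0 ≤ c` and `4π²|k|² ν c ≤ 1`, `δ_u` is a probability measure with finite mean enstrophy (1.29), the
shell energy inequalities (1.31) and integrable energy. -/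
theorem ray_dirac_subStationary (hk : k ≠ 0) {ν : ℝ} (hc : 0 ≤ c)
    (hνc : ν * (4 * Real.pi ^ 2 * Torus.freqNormSq k) * c ≤ 1) :
    IsProbabilityMeasure (Measure.dirac u) ∧
      ∫⁻ v, Torus.eGradNormSq (((v : (Torus.energySpace (Fin 3))) : (Lp (EuclideanSpace ℝ (Fin 3)) 2 (volume : Measure (UnitAddTorus (Fin 3))))) : (UnitAddTorus (Fin 3) → EuclideanSpace ℝ (Fin 3))) ∂(Measure.dirac u) < ∞ ∧
      (∀ e₁ e₂ : ℝ≥0∞, e₁ < e₂ →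
        ∫ v in {v : (Torus.energySpace (Fin 3)) | e₁ ≤ ‖v‖ₑ ^ 2 ∧ ‖v‖ₑ ^ 2 < e₂},
          (ν * (Torus.eGradNormSq (((v : (Torus.energySpace (Fin 3))) : (Lp (EuclideanSpace ℝ (Fin 3)) 2 (volume : Measure (UnitAddTorus (Fin 3))))) : (UnitAddTorus (Fin 3) → EuclideanSpace ℝ (Fin 3)))).toReal - Torus.pairing ((v : (Torus.energySpace (Fin 3))) : (Lp (EuclideanSpace ℝ (Fin 3)) 2 (volume : Measure (UnitAddTorus (Fin 3))))) (Torus.realTrigPoly {k} (fun _ => z))) ∂(Measure.dirac u) ≤ 0) ∧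
      Integrable (fun v : (Torus.energySpace (Fin 3)) => ‖v‖ ^ 2) (Measure.dirac u) := by
  haveI : MeasurableSingletonClass (Torus.energySpace (Fin 3)) := OpensMeasurableSpace.toMeasurableSingletonClass
  refine ⟨inferInstance, ?_, ?_, Torus.integrable_dirac u _⟩
  · rw [lintegral_dirac]
    exact ray_eGradNormSq_lt_top hu
  · intro e₁ e₂ _
    classical
    rw [setIntegral_dirac]
    split_ifs
    · rw [ray_eGradNormSq hu hk, ray_pairing hu hk, sub_nonpos]
      have hz2 : 0 ≤ 2⁻¹ * (c * ‖z‖ ^ 2) := by positivity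
      calc ν * (4 * Real.pi ^ 2 * Torus.freqNormSq k * (2⁻¹ * (c ^ 2 * ‖z‖ ^ 2)))
          = (ν * (4 * Real.pi ^ 2 * Torus.freqNormSq k) * c) * (2⁻¹ * (c * ‖z‖ ^ 2)) := by ring
        _ ≤ 1 * (2⁻¹ * (c * ‖z‖ ^ 2)) := mul_le_mul_of_nonneg_right hνc hz2
        _ = 2⁻¹ * (c * ‖z‖ ^ 2) := one_mul _
    · exact le_rfl

end Ray

/-! ### The two sides of (b) at a ray state / ray Dirac mass -/

/-- **The right-hand side of (b) at a ray state**, with test field the mode itself: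
`ν ‖u‖_V ‖∇f‖ = 4π²|k|² ν c · ½‖z‖²` (`0 ≤ c`). -/
theorem ray_defect_rhs_state (hk : k ≠ 0) {c : ℝ} (hc : 0 ≤ c) {u : (Torus.energySpace (Fin 3))}
    (hu : (((u : (Torus.energySpace (Fin 3))) : (Lp (EuclideanSpace ℝ (Fin 3)) 2 (volume : Measure (UnitAddTorus (Fin 3))))) : (UnitAddTorus (Fin 3) → EuclideanSpace ℝ (Fin 3))) =ᵐ[volume] Torus.realTrigPoly {k} (fun _ => ((c : ℂ) • z))) (ν : ℝ) :
    ν * Real.sqrt (Torus.eGradNormSq (((u : (Torus.energySpace (Fin 3))) : (Lp (EuclideanSpace ℝ (Fin 3)) 2 (volume : Measure (UnitAddTorus (Fin 3))))) : (UnitAddTorus (Fin 3) → EuclideanSpace ℝ (Fin 3)))).toReal *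
        Real.sqrt (Torus.gradNormSq (Torus.realTrigPoly {k} (fun _ => z))) =
      (ν * (4 * Real.pi ^ 2 * Torus.freqNormSq k) * c) * (2⁻¹ * ‖z‖ ^ 2) := by
  rw [ray_eGradNormSq hu hk, gradNormSq_mode_eq hk]
  set A : ℝ := 4 * Real.pi ^ 2 * Torus.freqNormSq k * (2⁻¹ * ‖z‖ ^ 2) with hA
  have hA0 : 0 ≤ A := by
    have := Torus.freqNormSq_nonneg k
    positivity
  have h1 : 4 * Real.pi ^ 2 * Torus.freqNormSq k * (2⁻¹ * (c ^ 2 * ‖z‖ ^ 2)) = c ^ 2 * A := by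
    rw [hA]; ring
  rw [h1, Real.sqrt_mul (sq_nonneg c), Real.sqrt_sq hc]
  calc ν * (c * Real.sqrt A) * Real.sqrt A = ν * c * (Real.sqrt A * Real.sqrt A) := by ring
    _ = ν * c * A := by rw [Real.mul_self_sqrt hA0]
    _ = ν * (4 * Real.pi ^ 2 * Torus.freqNormSq k) * c * (2⁻¹ * ‖z‖ ^ 2) := by rw [hA]; ring

/-- **The left-hand side of (b) at a ray Dirac mass**, tested with a cylindrical functional whose
differential at `u` is the mode itself: `|∫ ⟨F₀(v), Φ'(v)⟩ dδ_u| = ½‖z‖²` (any `c`). -/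
theorem ray_defect_lhs (hk : k ≠ 0) (hz : ((fun j => ((k) j : ℂ)) ⬝ᵥ (WithLp.ofLp z)) = 0) {c : ℝ} {u : (Torus.energySpace (Fin 3))}
    (hu : (((u : (Torus.energySpace (Fin 3))) : (Lp (EuclideanSpace ℝ (Fin 3)) 2 (volume : Measure (UnitAddTorus (Fin 3))))) : (UnitAddTorus (Fin 3) → EuclideanSpace ℝ (Fin 3))) =ᵐ[volume] Torus.realTrigPoly {k} (fun _ => ((c : ℂ) • z)))
    {Φ : Torus.CylindricalTest (Fin 3)} (hΦ : Φ.grad u = Torus.realTrigPoly {k} (fun _ => z)) :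
    |∫ v, Torus.nsGeneratorPairing 0 (Torus.realTrigPoly {k} (fun _ => z)) v (Φ.grad v) ∂(Measure.dirac u)| = 2⁻¹ * ‖z‖ ^ 2 := by
  haveI : MeasurableSingletonClass (Torus.energySpace (Fin 3)) := OpensMeasurableSpace.toMeasurableSingletonClass
  rw [integral_dirac, hΦ, ray_eulerDefect_self hz hu hk]
  exact abs_of_nonneg (by positivity)

/-- **The right-hand side of (b) at a ray Dirac mass** (same test functional):
`ν (∫‖∇v‖² dδ_u)^{1/2} (∫‖∇Φ'(v)‖² dδ_u)^{1/2} = 4π²|k|² ν c · ½‖z‖²` (`0 ≤ c`). -/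
theorem ray_defect_rhs (hk : k ≠ 0) {c : ℝ} (hc : 0 ≤ c) {u : (Torus.energySpace (Fin 3))}
    (hu : (((u : (Torus.energySpace (Fin 3))) : (Lp (EuclideanSpace ℝ (Fin 3)) 2 (volume : Measure (UnitAddTorus (Fin 3))))) : (UnitAddTorus (Fin 3) → EuclideanSpace ℝ (Fin 3))) =ᵐ[volume] Torus.realTrigPoly {k} (fun _ => ((c : ℂ) • z)))
    {Φ : Torus.CylindricalTest (Fin 3)} (hΦ : Φ.grad u = Torus.realTrigPoly {k} (fun _ => z)) (ν : ℝ) :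
    ν * Real.sqrt (Torus.ensembleEnstrophy (Measure.dirac u)).toReal *
        Real.sqrt (∫ v, Torus.gradNormSq (Φ.grad v) ∂(Measure.dirac u)) =
      (ν * (4 * Real.pi ^ 2 * Torus.freqNormSq k) * c) * (2⁻¹ * ‖z‖ ^ 2) := by
  haveI : MeasurableSingletonClass (Torus.energySpace (Fin 3)) := OpensMeasurableSpace.toMeasurableSingletonClass
  unfold Torus.ensembleEnstrophy
  rw [lintegral_dirac, integral_dirac, hΦ]
  exact ray_defect_rhs_state hk hc hu ν

end Summit.AnomalousDissipation.AnomalousDissipation.Theorems.ResidualTransferSSS.Negative
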